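import Literature.AlgebraicGeometry.GroupSchemes.IdempotentSplittingFiniteFlat
import HarnessLib

/-!
# Complements on `Fix ε`: `fixMap` of a flat ∕ surjective morphism is flat ∕ surjective; kernel squares restrict to `Fix`

Topic `Literature/AlgebraicGeometry/GroupSchemes`; namespace `Literature.AlgebraicGeometry.GroupSchemes.IdempotentSplitting` (complements
to ★ `GroupSchemes/IdempotentSplittingFiniteFlat`, p844567).  Theorems only (no definition, no named fact, no instance, no notation,
no `sorry`).  Cell `hodgecm-mathlib` (D-0151), FLOOR 0, P6 «MOD programme», generic organ for the P6b line's
`stub_L42_idempotentSplitting` σ1 «fixed locus + direct-factor flatness»: the two facts the assembly of the Barsotti–Tate group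
`(Fix εₙ)ₙ` needs beyond ★ — (β) the restricted `[p]`-maps `Fix ε_{n+1} → Fix ε_n` are FLAT and SURJECTIVE, and the kernel squares
`G_n = G_{n+1}[p^n]` RESTRICT to `Fix`; `--supports stmt-HodgeConjecture-24832`, COUNT-NEUTRAL (HC_CM is proved only modulo the
printed citations until rung 0 closes; nothing here is about HC).

THE PRINT.  [GortzWedhorn2020] (4.15) Definition 4.45 (2) (kernels of homomorphisms of group schemes as fibre products with the unit
section; subgroup schemes); [AtiyahMacdonald1969] Ch. 2 Exercise 4 (a direct summand of a flat module is flat), in the scheme form ★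
`Morphisms.flat_of_retract`.  The point of §1: for idempotents `ε`, `ε'` with `φ ≫ ε' = ε ≫ φ`, the restriction
`Fix φ : Fix ε → Fix ε'` is NOT a base change of `φ`, but it is a RETRACT, over `Fix ε'`, of the base change `G ×_{G'} Fix ε' → Fix ε'`
(section `(ι, Fix φ)`, retraction `pr₁ ≫ ε`), so flatness and surjectivity of `φ` pass to `Fix φ`.

WHAT IS HERE:
* §1 `fixMap_left_comp_fixι_left`, `exists_retract_fixMap_left` (the retract data for Mathlib's chosen `pullback`),
  **`flat_fixMap_left`**, **`surjective_fixMap_left`**;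
* §2 `pow_id_comp_eq_comp_pow_id` (`[N]` commutes with homomorphisms), **`fixMap_pow_id`** (`Fix [N] = [N]` for `fixGrpObj`),
  **`isPullback_fixMap_of_isPullback_unit`** (a kernel square `IsPullback i (toUnit K) φ η[M]` with compatible endomorphisms restricts
  to `IsPullback (Fix i) (toUnit _) (Fix φ) η[Fix εM]`).

## References
* [GortzWedhorn2020] U. Görtz, T. Wedhorn, *Algebraic Geometry I*, 2nd ed. (2020), (4.15) Definition 4.45 (2) (p. 117).
* [AtiyahMacdonald1969] M. F. Atiyah, I. G. Macdonald, *Introduction to Commutative Algebra* (1969), Ch. 2 Exercise 4 (p. 31).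
-/

noncomputable section

universe u

open CategoryTheory CategoryTheory.Limits AlgebraicGeometry MonoidalCategory CartesianMonoidalCategory

namespace Literature.AlgebraicGeometry.GroupSchemes

namespace IdempotentSplitting

open scoped MonObj

/-! ## §1 `fixMap` along a flat (resp. surjective) morphism is flat (resp. surjective) -/

section Retract

variable {S : Scheme.{u}} {G G' : Over S} [GrpObj G] [GrpObj G'] (ε : G ⟶ G) (ε' : G' ⟶ G') (φ : G ⟶ G')
  (hε : ε ≫ ε = ε) (hε' : ε' ≫ ε' = ε') (hφ : φ ≫ ε' = ε ≫ φ)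

/-- On underlying schemes `fixMap ≫ ι' = ι ≫ φ`. [cite: GortzWedhorn2020, Definition 4.45 (2), p. 117] -/
theorem fixMap_left_comp_fixι_left : (fixMap ε ε' φ hφ).left ≫ (fixι ε').left = (fixι ε).left ≫ φ.left := by
  rw [← Over.comp_left, fixMap_ι, Over.comp_left]

include hε hε' in
/-- **`Fix ε → Fix ε'` is a RETRACT, over `Fix ε'`, of the base change `G ×_{G'} Fix ε' → Fix ε'` of `φ`** (idempotents
`ε`, `ε'` with `φ ≫ ε' = ε ≫ φ`): the section is `(ι, fixMap) : Fix ε → G ×_{G'} Fix ε'`, the retraction is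
`pr₁ ≫ ε : G ×_{G'} Fix ε' → Fix ε` (well defined over `Fix ε'` because `ε ≫ fixMap = φ ≫ ε'`, `fixRetract_comp_fixMap`).
[cite: AtiyahMacdonald1969, Ch. 2 Exercise 4 (p. 31)] -/
theorem exists_retract_fixMap_left :
    ∃ (j : (fix ε).left ⟶ pullback φ.left (fixι ε').left) (r : pullback φ.left (fixι ε').left ⟶ (fix ε).left),
      j ≫ r = 𝟙 _ ∧ r ≫ (fixMap ε ε' φ hφ).left = pullback.snd φ.left (fixι ε').left := by
  refine ⟨pullback.lift (fixι ε).left (fixMap ε ε' φ hφ).left (fixMap_left_comp_fixι_left ε ε' φ hφ).symm,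
    pullback.fst φ.left (fixι ε').left ≫ (fixRetract ε hε).left, ?_, ?_⟩
  · rw [pullback.lift_fst_assoc, ← Over.comp_left, fixι_fixRetract, Over.id_left]
  · rw [Category.assoc, ← Over.comp_left, fixRetract_comp_fixMap ε ε' φ hε hε' hφ, Over.comp_left, ← Category.assoc,
      pullback.condition, Category.assoc, ← Over.comp_left, fixι_fixRetract, Over.id_left, Category.comp_id]

include hε hε' in
/-- **`fixMap` of a FLAT morphism is flat** (idempotents `ε`, `ε'` commuting with `φ`): `Fix ε → Fix ε'` is a retract over
`Fix ε'` of the flat base change `G ×_{G'} Fix ε' → Fix ε'` of `φ`, and a retract of a flat scheme over a base is flat over it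
(★ `Morphisms.flat_of_retract`: a direct summand of a flat module is flat). [cite: AtiyahMacdonald1969, Ch. 2 Exercise 4 (p. 31)] -/
theorem flat_fixMap_left [Flat φ.left] : Flat (fixMap ε ε' φ hφ).left := by
  obtain ⟨j, r, hjr, hr⟩ := exists_retract_fixMap_left ε ε' φ hε hε' hφ
  haveI : Flat (pullback.snd φ.left (fixι ε').left) := MorphismProperty.pullback_snd _ _ inferInstance
  exact Morphisms.flat_of_retract _ (pullback.snd φ.left (fixι ε').left) j r hr hjr

include hε hε' in
/-- **`fixMap` of a SURJECTIVE morphism is surjective** (same retract: a point `y` of `Fix ε'` lifts to the surjective base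
change `G ×_{G'} Fix ε' → Fix ε'`, and the retraction carries the lift to a point of `Fix ε` over `y`).
[cite: GortzWedhorn2020, Definition 4.45 (2), p. 117] -/
theorem surjective_fixMap_left [Surjective φ.left] : Surjective (fixMap ε ε' φ hφ).left := by
  obtain ⟨j, r, -, hr⟩ := exists_retract_fixMap_left ε ε' φ hε hε' hφ
  haveI : Surjective (pullback.snd φ.left (fixι ε').left) := MorphismProperty.pullback_snd _ _ inferInstance
  refine ⟨fun y => ?_⟩
  obtain ⟨x, hx⟩ := (pullback.snd φ.left (fixι ε').left).surjective y
  exact ⟨r x, by rw [← Scheme.Hom.comp_apply, hr, hx]⟩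

end Retract

/-! ## §2 Powers of the identity and kernel squares restrict to `Fix` -/

section Kernel

variable {S : Scheme.{u}}

/-- Multiplication by `N` commutes with every homomorphism: `[N] ≫ ε = ε ≫ [N]`. [cite: GortzWedhorn2020, Definition 4.45 (2), p. 117] -/
theorem pow_id_comp_eq_comp_pow_id {G G' : Over S} [GrpObj G] [GrpObj G'] (φ : G ⟶ G') [IsMonHom φ] (N : ℕ) :
    ((𝟙 G) ^ N) ≫ φ = φ ≫ (𝟙 G') ^ N := by
  rw [MonObj.pow_comp, Category.id_comp, MonObj.comp_pow, Category.comp_id]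

/-- **`Fix` of multiplication by `N` is multiplication by `N` on `Fix ε`** (for the subgroup-scheme structure `fixGrpObj`).
[cite: GortzWedhorn2020, Definition 4.45 (2), p. 117] -/
theorem fixMap_pow_id {G : Over S} [GrpObj G] [IsCommMonObj G] (ε : G ⟶ G) [IsMonHom ε] (N : ℕ)
    (h : ((𝟙 G) ^ N) ≫ ε = ε ≫ (𝟙 G) ^ N) :
    fixMap ε ε ((𝟙 G) ^ N) h = (letI := fixGrpObj ε; (𝟙 (fix ε)) ^ N) := by
  letI := fixGrpObj ε
  haveI := isMonHom_fixι ε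
  apply fix_hom_ext ε
  rw [fixMap_ι, MonObj.pow_comp, Category.id_comp, MonObj.comp_pow, Category.comp_id]

/-- **KERNEL SQUARES RESTRICT TO FIXED SUBGROUP SCHEMES.**  Let `K →(i) G →(φ) M ←(e) 𝟙` be cartesian (`K = Ker φ`) for
`S`-group schemes `K, G, M` (`M` commutative) carrying endomorphisms `εK, εG, εM` compatible with `i` and `φ`, with `εM` a
homomorphism (so that `Fix εM` is a subgroup scheme).  Then `Fix εK →(Fix i) Fix εG →(Fix φ) Fix εM ←(e) 𝟙` is cartesian:
`Fix εK = Ker (Fix φ)` — a `T`-point `t` of `Fix εG` killed by `Fix φ` lifts uniquely to `K` by the kernel square, and the lift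
is `εK`-fixed by the uniqueness half of the same square. [cite: GortzWedhorn2020, Definition 4.45 (2), p. 117] -/
theorem isPullback_fixMap_of_isPullback_unit {K G M : Over S} [GrpObj K] [GrpObj G] [GrpObj M] [IsCommMonObj M]
    (εK : K ⟶ K) (εG : G ⟶ G) (εM : M ⟶ M) [IsMonHom εM] (i : K ⟶ G) (φ : G ⟶ M) (hi : i ≫ εG = εK ≫ i)
    (hφ : φ ≫ εM = εG ≫ φ) (hK : IsPullback i (toUnit K) φ η[M]) :
    letI := fixGrpObj εM
    IsPullback (fixMap εK εG i hi) (toUnit (fix εK)) (fixMap εG εM φ hφ) η[fix εM] := by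
  letI := fixGrpObj εM
  haveI := isMonHom_fixι εM
  haveI := mono_fixι εG
  haveI := mono_fixι εM
  -- the square commutes (test after the monomorphism `ι_M`)
  have hw : fixMap εK εG i hi ≫ fixMap εG εM φ hφ = toUnit (fix εK) ≫ η[fix εM] := by
    rw [← cancel_mono (fixι εM), Category.assoc, Category.assoc, fixMap_ι, fixMap_ι_assoc, hK.w, IsMonHom.one_hom,
      ← Category.assoc, toUnit_unique (fixι εK ≫ toUnit K) (toUnit _)]
  -- the lift of a cone: first to `K` by the kernel square, then to `Fix εK`
  have hcone : ∀ s : PullbackCone (fixMap εG εM φ hφ) η[fix εM],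
      (s.fst ≫ fixι εG) ≫ φ = toUnit s.pt ≫ η[M] := fun s => by
    rw [Category.assoc, ← fixMap_ι εG εM φ hφ, ← Category.assoc, s.condition, Category.assoc, IsMonHom.one_hom,
      toUnit_unique s.snd (toUnit _)]
  have hfixed : ∀ s : PullbackCone (fixMap εG εM φ hφ) η[fix εM],
      hK.lift (s.fst ≫ fixι εG) (toUnit s.pt) (hcone s) ≫ εK = hK.lift (s.fst ≫ fixι εG) (toUnit s.pt) (hcone s) :=
    fun s => by
    apply hK.hom_ext
    · rw [Category.assoc, ← hi, ← Category.assoc, hK.lift_fst, Category.assoc, fixι_comp]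
    · exact toUnit_unique _ _
  refine IsPullback.of_isLimit' ⟨hw⟩ (PullbackCone.IsLimit.mk hw
    (fun s => fixLift εK (hK.lift (s.fst ≫ fixι εG) (toUnit s.pt) (hcone s)) (hfixed s))
    (fun s => ?_) (fun s => toUnit_unique _ _) (fun s m hm₁ _ => ?_))
  · apply fix_hom_ext εG
    rw [Category.assoc, fixMap_ι, fixLift_ι_assoc, hK.lift_fst]
  · apply fix_hom_ext εK
    rw [fixLift_ι]
    apply hK.hom_ext
    · rw [hK.lift_fst, Category.assoc, ← fixMap_ι εK εG i hi, ← Category.assoc, hm₁]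
    · exact toUnit_unique _ _

end Kernel

end IdempotentSplitting

end Literature.AlgebraicGeometry.GroupSchemes

end
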